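import Literature.NumberTheory.Transcendental.BoxIntegralZetaValues
import Literature.NumberTheory.Transcendental.KZCalculus

/-!
# `NormalFormPrinciple` (stmt-KontsevichZagierPeriods-3869), line `SketchIdeator1` —
# the leaf `stub_boxRigidity` in dimension `w`, level one: the value of `[(0,1)ʷ, β/(1 − ∏ᵢ xᵢ)]`

Pure proof file (stub `value_zetaRep_dim` of the dimension climb, lead seat c7; `--supports` the
crux). The `ζ(w)` carrier of the level-one normal form
`Σ_{j=2}^{w} [(0,1)ʲ, β_j/(1 − ∏ x)] + [pt, q]` represents `β · ζ(w)`: for an integral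
representation `B` of dimension `w ≥ 2` (`Literature.NumberTheory.Transcendental.KZ.IntegralRep w`)
whose domain is the open unit box and whose integrand agrees with `x ↦ β/(1 − x₀⋯x_{w−1})` there,

  `B.value = ∫_{(0,1)ʷ} β dx/(1 − x₀⋯x_{w−1}) = β · ζ(w)`

(the Beukers-type box integral `∫_{(0,1)ʷ} dx/(1 − ∏ᵢ xᵢ) = ζ(w)`, the tree's
`BoxIntegral.setIntegral_box_one_div_one_sub_prod_eq_zetaValue`, after the constant `β` is pulled
out of the set integral; `ζ(w) = zetaValue w` of `PeriodsWave0.lean`).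

Sources: M. Kontsevich, D. Zagier, *Periods* (2001), §1.1; F. Beukers, *A note on the
irrationality of ζ(2) and ζ(3)*, Bull. LMS 11 (1979). No definitions are introduced.
-/

noncomputable section

open MeasureTheory Set
open Literature.NumberTheory.Transcendental Literature.NumberTheory.Transcendental.KZ

namespace Summit.KontsevichZagierPeriods.HurwitzMicroSectors.NormalFormPrinciple.PiBox.LevelOne

/-- **E (value of a `ζ(w)` carrier of the level-one normal form).** An integral representation of
dimension `w ≥ 2` on the open unit box `(0,1)ʷ` with integrand `β/(1 − x₀⋯x_{w−1})` (`β ∈ ℚ`)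
represents `β · ζ(w)` (the box integral `∫_{(0,1)ʷ} dx/(1 − ∏ᵢ xᵢ) = ζ(w) = zetaValue w`).
[cite: KontsevichZagier2001, §1.1] -/
theorem value_zetaRep_dim {w : ℕ} (hw : 2 ≤ w) (β : ℚ) (B : IntegralRep w)
    (hBd : B.domain = {x | ∀ i, x i ∈ Set.Ioo (0:ℝ) 1})
    (hBi : EqOn B.integrand (fun x => (β : ℝ) / (1 - ∏ i, x i)) B.domain) :
    B.value = (β : ℝ) * zetaValue w := by
  rw [KZ.IntegralRep.value, setIntegral_congr_fun (KZ.IntegralRep.measurableSet_domain_holds B) hBi,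
    hBd]
  simp_rw [div_eq_mul_one_div (β : ℝ)]
  rw [integral_const_mul,
    Literature.NumberTheory.Transcendental.BoxIntegral.setIntegral_box_one_div_one_sub_prod_eq_zetaValue
      hw]

end Summit.KontsevichZagierPeriods.HurwitzMicroSectors.NormalFormPrinciple.PiBox.LevelOne
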